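import Mathlib
import Summits.Ventures.HodgeRepro2.T6N5RealPlace

/-!
# T6N5FockCarrier — the archimedean Fock dictionary in its conjugate-orthogonal (even-weight) form, and the
(U(1),U(1)) K-type carrier on which it is a THEOREM from two print-shaped interface statements and the weight
dictionary (the kernel shape of the FockDict discharge; no display is filed here — the print is W-11)

Tier 6 (README §10), sub-step N5 of the M2 discharge (t6-p7).  `T6N5RealPlace` (p410050) carries the one
interface residual of condition (b) at the real places as the Prop `RealData.FockDict`, quantified over ALL
weights `k : ℤ`.  The characters at which the theta predicate is consumed are the `α_K = α ∘ j` of the line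
characters, of EVEN weight `2χ_i` (`RealData.αK`), so the all-`k` form says more than any printed statement
about the (U(1),U(1)) theta correspondence of characters of `K¹` can give (a character of `K¹` carried through
`j : K^× → K¹` has even weight).  This file:

1. states the CONJUGATE-ORTHOGONAL form `RealData.FockDictCO` (the same dichotomy at the even weights `2χ`
   only — strictly weaker than `FockDict`, `FockDict.toCO`), and re-derives `condB_line` /
   `realCondB_ofReal` / `Verdict.realCondB` from it (`condB_line_CO`, `realCondB_ofReal_CO`,
   `Verdict.realCondB_CO`) — the binder of the rich lane (`N5RealPlace.realCondB_ofReal`, p410050) can be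
   taken in the CO form without any other change;

2. introduces the (U(1),U(1)) K-TYPE CARRIER `KTypeCarrier` (data: the occurrence predicate «the K_V-type of
   b_{V,ψ}-highest weight `l` lies in the joint harmonics R(K_V, J_{V,W,ξ})» and the lift predicate «the
   character of U(V) of weight `l` lies in R(G_V, ω_{W,ξ})», for the hermitian line V of sign `sV`, the
   skew-hermitian line W of sign `sW` and the additive character of sign `εψ`), the two PRINT-SHAPED interface
   statements `KTypeHalfLine` (Konno–Konno 2007 Theorem 5.4(i) specialised to p + q = 1 = p′ + q′: the
   occurrence set is the half-line `{l ≤ 0}` when `εψ·sV·sW = 1` and `{l ≥ 1}` when `εψ·sV·sW = −1`) and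
   `HoweCompact` (the K-type bijection of the joint harmonics IS the Howe correspondence for the compact pair:
   Konno–Konno 2007 Fact 5.1 (2)/(3) [Howe 1989 §3], Kashiwara–Vergne 1978), the WEIGHT DICTIONARY
   `kkWeight` (MEMO §10.2's calibration, EX class: the character of torus weight `χ`, carried as `α_K` of
   weight `k = 2χ` and twisted by the splitting character `χ_W` of odd weight `m′_A`, is the character of
   b_{V,ψ}-highest weight `(k − m′_A + 1)/2`), and the theta predicate `thetaOf` read off the carrier;

3. proves `fockDictCO_of_carrier`: for a real-place datum whose theta predicate is `thetaOf` (the EX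
   identification), `FockDictCO` follows from `KTypeHalfLine`, `HoweCompact`, the calibration `εψ·sW = −1`
   and the oddness of `m′_A` — so on this carrier the residual «(b) at the real places» is the pair of
   print-shaped statements (class PO once their displays carry the print: KK07 Theorem 5.4(i) journal p. 75
   via WANTED W-11, KK07 Fact 5.1 journal p. 71 — held layer paper:doi-10-2206-kyushujm-61-35 p0037
   ll. 52–71, prose clean) plus EX, no IR;

4. exhibits the joint non-vacuity (README §10.5(ii)(c)/(d)): the half-line carrier `Toy.carrier` satisfies
   both interface statements, and the real-place datum `Toy.toyReal` read off it satisfies the displayed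
   Epsilon Dichotomy (`Hyp.BFGYYZ2025_Thm3_5`), `FockDictCO` (through `fockDictCO_of_carrier`) and the
   half-line inequalities at once, yielding (b).

The two interface Props are the kernel SHAPES of the displays to come — their statements are read from the
held page layer (Theorem 5.4(i): p0041 ll. 33–39, 62–69, 92–100 prose with (5.6)/(5.7) exploded; the
specialisation to lines is the owner's arithmetic, route/T6-N5-t6-p7.md §14) and are to be verified against
the print before any `Hyp.*` display is filed; nothing here is a display, a hypothesis of the scored record,
or a statement about the route beyond kernel arithmetic.  Count-neutral.
§8(d): uses an L-value-free non-vanishing device: NO.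
-/

namespace Summit.Ventures.HodgeRepro2.T6.N5RealPlace.RealData

open Summit.Ventures.HodgeRepro2.T6.N5LocalDatum Summit.Ventures.HodgeRepro2.T6.N5Rich
  Summit.Ventures.HodgeRepro2.T6.Hyp

variable (R : RealData)

/-- THE CONJUGATE-ORTHOGONAL FORM OF THE ARCHIMEDEAN FOCK DICTIONARY: the half-line dichotomy of
`RealData.FockDict` at the EVEN weights `2χ` only — the weights of the characters `α_K = α ∘ j` of
characters `α` of `K¹`, the only weights at which the theta predicate is ever consumed (`RealData.αK`).
For `s = +1` (W₊): Θ ≠ 0 iff `2χ ≥ m′_A + 1`; for `s = −1` (W₋): iff `2χ ≤ m′_A − 1`.  Strictly weaker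
than `FockDict`; exactly the content of the (U(1),U(1)) theta correspondence of characters of `K¹` in
weight form (MEMO §10.4(C)). -/
def FockDictCO : Prop :=
  ∀ (s : ℤˣ) (χ : ℤ), R.Theta s (Multiplicative.ofAdd (2 * χ)) ↔
    ((s = 1 → R.mA' + 1 ≤ 2 * χ) ∧ (s = -1 → 2 * χ ≤ R.mA' - 1))

/-- The all-weight dictionary implies its conjugate-orthogonal form. -/
theorem FockDict.toCO (h : R.FockDict) : R.FockDictCO := fun s χ => h s (2 * χ)

/-- CONDITION (b) AT A REAL PLACE FOR ONE LINE from the displayed Epsilon Dichatomy, the conjugate-orthogonal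
Fock dictionary and the half-line inequality (the proof of `condB_line`, which only ever evaluates the
dictionary at the even weight `2χ_i`). -/
theorem condB_line_CO (h35 : BFGYYZ2025_Thm3_5 R.toLocal) (hF : R.FockDictCO) (i : Fin 2)
    (hH : R.HalfLine i) : R.eps (R.ξ i) = R.sign i := by
  have key := h35 (R.sign i) (R.αK i) (R.isCO_αK i)
  have hθ : R.Theta (R.sign i) (R.αK i) := (hF (R.sign i) (R.χ i)).mpr hH
  have h := key.mp hθ
  change R.eps ((Multiplicative.ofAdd R.mA')⁻¹ * R.αK i) = R.sign i * 1 at h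
  rw [R.χW_inv_mul_αK, mul_one] at h
  exact h

end Summit.Ventures.HodgeRepro2.T6.N5RealPlace.RealData

namespace Summit.Ventures.HodgeRepro2.T6.N5RealPlace

open Summit.Ventures.HodgeRepro2.T6.N5LocalDatum Summit.Ventures.HodgeRepro2.T6.N5Rich
  Summit.Ventures.HodgeRepro2.T6.Hyp

/-- CONDITION (b) AT THE REAL PLACES, BOTH SIDES, from the display, the conjugate-orthogonal Fock dictionary
and the half-line inequalities at every real place (`realCondB_ofReal` with `FockDict` weakened to
`FockDictCO`). -/
theorem realCondB_ofReal_CO {ι : Type*} (kind : ι → PlaceKind) (D : ι → LocalSignDatum)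
    (ξ : ∀ v, Fin 4 → (D v).Char) (RA RB : ι → RealData)
    (h35A : ∀ v, kind v = .re → BFGYYZ2025_Thm3_5 (RA v).toLocal)
    (h35B : ∀ v, kind v = .re → BFGYYZ2025_Thm3_5 (RB v).toLocal)
    (hFA : ∀ v, kind v = .re → (RA v).FockDictCO) (hFB : ∀ v, kind v = .re → (RB v).FockDictCO)
    (hHA : ∀ v, kind v = .re → ∀ i, (RA v).HalfLine i)
    (hHB : ∀ v, kind v = .re → ∀ i, (RB v).HalfLine i) :
    (SignModel.ofReal kind D ξ RA RB).RealCondB := by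
  intro v hv i
  exact ⟨((RA v).condB_line_CO (h35A v hv) (hFA v hv) i (hHA v hv i)).symm,
    ((RB v).condB_line_CO (h35B v hv) (hFB v hv) i (hHB v hv i)).symm⟩

/-- CONDITION (b) AT THE THREE REAL PLACES FOR THE VERDICT DATA from the display and the conjugate-orthogonal
Fock dictionary alone (`Verdict.realCondB` with `FockDict` weakened to `FockDictCO`). -/
theorem Verdict.realCondB_CO (V : Verdict) (kind : Fin 3 → PlaceKind) (D : Fin 3 → LocalSignDatum)
    (ξ : ∀ v, Fin 4 → (D v).Char)
    (h35A : ∀ j, BFGYYZ2025_Thm3_5 (V.realA j).toLocal)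
    (h35B : ∀ j, BFGYYZ2025_Thm3_5 (V.realB j).toLocal)
    (hFA : ∀ j, (V.realA j).FockDictCO) (hFB : ∀ j, (V.realB j).FockDictCO) :
    (SignModel.ofReal kind D ξ V.realA V.realB).RealCondB :=
  realCondB_ofReal_CO kind D ξ V.realA V.realB (fun j _ => h35A j) (fun j _ => h35B j)
    (fun j _ => hFA j) (fun j _ => hFB j) (fun j _ i => V.realA_halfLine j i)
    (fun j _ i => V.realB_halfLine j i)

end Summit.Ventures.HodgeRepro2.T6.N5RealPlace

namespace Summit.Ventures.HodgeRepro2.T6.N5Fock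

open Summit.Ventures.HodgeRepro2.T6.N5LocalDatum Summit.Ventures.HodgeRepro2.T6.Hyp
  Summit.Ventures.HodgeRepro2.T6.N5RealPlace

/-! ## The (U(1),U(1)) K-type carrier -/

/-- A half-line of integer weights: `{base + dir · a : a ∈ ℕ}`. -/
def HalfLineSet (base : ℤ) (dir : ℤˣ) (l : ℤ) : Prop := ∃ a : ℕ, l = base + (dir : ℤ) * a

/-- The half-line of direction `+1` is `{l ≥ base}`. -/
theorem halfLineSet_one_iff (base l : ℤ) : HalfLineSet base 1 l ↔ base ≤ l := by
  constructor
  · rintro ⟨a, rfl⟩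
    simp
  · intro h
    exact ⟨(l - base).toNat, by simp; omega⟩

/-- The half-line of direction `−1` is `{l ≤ base}`. -/
theorem halfLineSet_neg_one_iff (base l : ℤ) : HalfLineSet base (-1) l ↔ l ≤ base := by
  constructor
  · rintro ⟨a, rfl⟩
    simp
  · intro h
    exact ⟨(base - l).toNat, by simp; omega⟩

/-- THE (U(1),U(1)) K-TYPE CARRIER at one real place (Konno–Konno 2007 §5 for a hermitian LINE `V` of sign
`sV` and a skew-hermitian LINE `W` of sign `sW`, the additive character `ψ` of sign `εψ = dψ/(|dψ| i)`): the
K_V-types are the characters of `K_V = U(V) = U(1)`, indexed by their b_{V,ψ}-highest weight `l : ℤ`.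
Data only: `occ sV sW εψ l` carries «the K_V-type of weight `l` belongs to R(K_V, J_{V,W,ξ})» (the joint
harmonics, Fact 5.1 (2)), `lift sV sW εψ l` carries «the character of U(V) of weight `l` belongs to
R(G_V, ω_{W,ξ})» (it occurs as a quotient of the Weil representation — the Howe lift is non-zero). -/
structure KTypeCarrier where
  /-- «the K_V-type of b_{V,ψ}-highest weight `l` lies in R(K_V, J_{V,W,ξ})» -/
  occ : ℤˣ → ℤˣ → ℤˣ → ℤ → Prop
  /-- «the character of U(V) of weight `l` lies in R(G_V, ω_{W,ξ})» -/
  lift : ℤˣ → ℤˣ → ℤˣ → ℤ → Prop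

/-- KERNEL SHAPE of Konno–Konno 2007 Theorem 5.4(i) (K-type correspondence) specialised to lines
(p + q = 1 = p′ + q′, m = 1): a K_V-type of b_{V,ψ}-highest weight `l` belongs to R(K_V, J_{V,W,ξ}) iff `l`
lies on the half-line `{l ≤ 0}` when `εψ·sV·sW = +1` and on `{l ≥ 1}` when `εψ·sV·sW = −1` (the constant
vector of (5.6) at a line is `(1 − εψ·sV·sW)/2` and the variable part `εψ·(−a)` resp. `εψ·b` with the
constraints `r + t ≤ p′`, `s + u ≤ q′` selecting the direction — owner's arithmetic route/T6-N5-t6-p7.md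
§14, to be verified against the print (W-11) before the display is filed).  Interface Prop, not a
display. -/
def KTypeHalfLine (C : KTypeCarrier) : Prop :=
  ∀ (sV sW εψ : ℤˣ) (l : ℤ), C.occ sV sW εψ l ↔
    ((εψ * sV * sW = 1 → l ≤ 0) ∧ (εψ * sV * sW = -1 → 1 ≤ l))

/-- KERNEL SHAPE of Howe duality for the compact dual pair (Konno–Konno 2007 Fact 5.1 (2)/(3) [Howe 1989 §3];
Kashiwara–Vergne 1978): for `G_V = K_V = U(1)` the character of weight `l` occurs as a quotient of the Weil
representation iff its K-type lies in the joint harmonics.  Interface Prop, not a display. -/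
def HoweCompact (C : KTypeCarrier) : Prop :=
  ∀ (sV sW εψ : ℤˣ) (l : ℤ), C.lift sV sW εψ l ↔ C.occ sV sW εψ l

/-- THE WEIGHT DICTIONARY (MEMO §10.2's calibration; EX class): the character `α` of `K¹` of torus weight `χ`,
carried as `α_K = α ∘ j` of weight `k = 2χ` and twisted by the splitting character `χ_W` of odd weight
`m′_A`, is the character of `U(V)` of b_{V,ψ}-highest weight `(k − m′_A + 1)/2` (an integer for even `k`). -/
def kkWeight (mA' k : ℤ) : ℤ := (k - mA' + 1) / 2

/-- The theta predicate of a real-place datum READ OFF the carrier: «Θ_{V_s,W}(α ∘ i′_V) ≠ 0» iff the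
character of weight `kkWeight m′_A k` of `U(V_s)` lifts (the datum's W has sign `sW`, its ψ sign `εψ`). -/
def thetaOf (C : KTypeCarrier) (sW εψ : ℤˣ) (mA' : ℤ) : ℤˣ → Wt → Prop :=
  fun s w => C.lift s sW εψ (kkWeight mA' (Multiplicative.toAdd w))

/-- The weight dictionary at an even weight `2χ` with `m′_A = 2n + 1`: `kkWeight (2n+1) (2χ) = χ − n`. -/
theorem kkWeight_even (n χ : ℤ) : kkWeight (2 * n + 1) (2 * χ) = χ - n := by
  unfold kkWeight
  omega

/-- THE CONJUGATE-ORTHOGONAL FOCK DICTIONARY IS A THEOREM ON THE CARRIER: for a real-place datum whose theta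
predicate is read off a K-type carrier (`hT`, the EX identification), with the calibration `εψ · sW = −1`
(MEMO §10.2: Liu's W₊ is the KK07 line with `εψ·sW = −1`) and `m′_A` odd, the two print-shaped interface
statements give `FockDictCO`. -/
theorem fockDictCO_of_carrier (R : RealData) (C : KTypeCarrier) (sW εψ : ℤˣ)
    (hcal : εψ * sW = -1) (hodd : Odd R.mA')
    (hT : ∀ s w, R.Theta s w ↔ thetaOf C sW εψ R.mA' s w)
    (hK : KTypeHalfLine C) (hH : HoweCompact C) : R.FockDictCO := by
  intro s χ
  rw [hT]
  unfold thetaOf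
  rw [hH, hK, toAdd_ofAdd]
  obtain ⟨n, hn⟩ := hodd
  rw [hn, kkWeight_even]
  rcases Int.units_eq_one_or s with hs | hs <;> rcases Int.units_eq_one_or εψ with he | he <;>
    rcases Int.units_eq_one_or sW with hw | hw <;> subst hs he hw <;> simp at hcal ⊢ <;> omega

/-! ## Non-vacuity (README §10.5(ii)(c)/(d)): the half-line carrier and a real-place datum read off it -/

namespace Toy

/-- The half-line carrier: both predicates ARE the half-line rule. -/
def carrier : KTypeCarrier where
  occ := fun sV sW εψ l => (εψ * sV * sW = 1 → l ≤ 0) ∧ (εψ * sV * sW = -1 → 1 ≤ l)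
  lift := fun sV sW εψ l => (εψ * sV * sW = 1 → l ≤ 0) ∧ (εψ * sV * sW = -1 → 1 ≤ l)

/-- The half-line carrier satisfies the K-type half-line statement. -/
theorem carrier_kTypeHalfLine : KTypeHalfLine carrier := fun _ _ _ _ => Iff.rfl

/-- The half-line carrier satisfies the compact Howe duality statement. -/
theorem carrier_howeCompact : HoweCompact carrier := fun _ _ _ _ => Iff.rfl

/-- The toy real-place datum read off the carrier: `m′_A = 1`, W of sign `−1`, `εψ = +1`, the theta predicate
`thetaOf carrier (−1) 1 1`, the root number of the weight-`j` character `+1` iff `1 ≤ j`, lines of signs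
`(+1, −1)` and torus weights `(2, 0)`. -/
def toyReal : RealData where
  eps := fun β => if 1 ≤ Multiplicative.toAdd β then 1 else -1
  mA' := 1
  Theta := thetaOf carrier (-1) 1 1
  sign := ![1, -1]
  ηu := 1
  χ := ![2, 0]

/-- The toy's theta predicate is the carrier's (by definition). -/
theorem toyReal_theta (s : ℤˣ) (w : Wt) : toyReal.Theta s w ↔ thetaOf carrier (-1) 1 1 s w := Iff.rfl

/-- The toy satisfies the conjugate-orthogonal Fock dictionary, THROUGH the carrier theorem. -/
theorem toyReal_fockDictCO : toyReal.FockDictCO :=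
  fockDictCO_of_carrier toyReal carrier (-1) 1 (by decide) ⟨0, by decide⟩ toyReal_theta
    carrier_kTypeHalfLine carrier_howeCompact

/-- The toy's theta predicate, unfolded at a weight: Θ ≠ 0 iff `s = 1 → 1 ≤ k/2` and `s = −1 → k/2 ≤ 0`
(`kkWeight 1 k = k/2`). -/
theorem toyReal_theta_iff (s : ℤˣ) (α : Wt) : toyReal.Theta s α ↔
    ((1 * s * -1 = 1 → (Multiplicative.toAdd α - 1 + 1) / 2 ≤ 0) ∧
      (1 * s * -1 = -1 → 1 ≤ (Multiplicative.toAdd α - 1 + 1) / 2)) := Iff.rfl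

/-- The displayed Epsilon Dichotomy holds on the toy real-place datum (the parity of conjugate-orthogonal
weights makes the root-number rule and the carrier's half-line rule agree). -/
theorem toyReal_thm3_5 : BFGYYZ2025_Thm3_5 toyReal.toLocal := by
  change ∀ (s : ℤˣ) (α : Wt), resR α = 1 → (toyReal.Theta s α ↔
    (if 1 ≤ Multiplicative.toAdd ((Multiplicative.ofAdd (1 : ℤ))⁻¹ * α) then (1 : ℤˣ) else -1) = s * 1)
  intro s α hα
  have hev : Even (Multiplicative.toAdd α) := by
    apply even_of_resR_eq_one
    rw [ofAdd_toAdd]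
    exact hα
  obtain ⟨m, hm⟩ := hev
  rw [toyReal_theta_iff, toAdd_mul, toAdd_inv, toAdd_ofAdd, mul_one, hm]
  rcases Int.units_eq_one_or s with rfl | rfl
  · constructor
    · rintro ⟨-, h2⟩
      have := h2 (by decide)
      rw [if_pos (by omega)]
    · intro h
      refine ⟨fun h' => absurd h' (by decide), fun _ => ?_⟩
      by_contra hlt
      rw [if_neg (by omega)] at h
      exact absurd h (by decide)
  · constructor
    · rintro ⟨h1, -⟩
      have := h1 (by decide)
      rw [if_neg (by omega)]
    · intro h
      refine ⟨fun _ => ?_, fun h' => absurd h' (by decide)⟩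
      by_contra hlt
      rw [if_pos (by omega)] at h
      exact absurd h (by decide)

/-- The toy's two lines satisfy the half-line inequalities. -/
theorem toyReal_halfLine (i : Fin 2) : toyReal.HalfLine i := by
  unfold RealData.HalfLine toyReal
  fin_cases i <;> simp

/-- JOINT NON-VACUITY: the two interface statements on the carrier, the display, the conjugate-orthogonal
dictionary and the half-lines on the datum read off it, and the sign equation (b) they yield. -/
theorem toyReal_joint : KTypeHalfLine carrier ∧ HoweCompact carrier ∧
    BFGYYZ2025_Thm3_5 toyReal.toLocal ∧ toyReal.FockDictCO ∧ (∀ i, toyReal.HalfLine i) ∧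
    ∀ i, toyReal.eps (toyReal.ξ i) = toyReal.sign i :=
  ⟨carrier_kTypeHalfLine, carrier_howeCompact, toyReal_thm3_5, toyReal_fockDictCO, toyReal_halfLine,
    fun i => toyReal.condB_line_CO toyReal_thm3_5 toyReal_fockDictCO i (toyReal_halfLine i)⟩

end Toy

end Summit.Ventures.HodgeRepro2.T6.N5Fock
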